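import Literature.Probability.RandomPlanarGeometry.HexSAWStripBridgeRenewalPointDensity
import Literature.Probability.RandomPlanarGeometry.HexSAWStripWidthTwoKernel
import Literature.Probability.Process.MatrixRenewalPiecesSecondMoment
import HarnessLib

/-!
# The number of renewal vertices of a long critical strip bridge CONCENTRATES: `#pieces/n → ν_T` in quadratic mean and in probability under
# the critical weighting, for every width `T ≥ 2` and every pair of levels (module «RENEWAL-POINT-LLN»)

Topic `Literature/Probability/RandomPlanarGeometry` (continues «RENEWAL-POINT-DENSITY» #692 `HexSAWStripBridgeRenewalPointDensity.lean` — the piece-count split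
`HV.pieces_eq_split` / `HV.hat_pieces_ren`, `HV.hat_pieces_facts`, and ★ `HV.tendsto_pieces_per_step`: `P̂(k)_{ab}/(n_k·D̂(k)_{ab}) → ν_T = ⟨ℓ,u⟩/⟨ℓ, M̄_len u⟩`
(the MEAN number of pieces per step); the length slices `HV.LUset/LMset`, `HV.hatM/hatD/hatLen/lchi`, `HV.hatPair`, `HV.hatPair_critical` of the
«LENGTH-POINTWISE(-LAW)» files; «AMPLITUDE-RATIO» #633 (`HV.tendsto_stripLenD_residue_explicit`); and the abstract half «MATRIX-RENEWAL-PIECES-LLN»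
`Process/MatrixRenewalPiecesSecondMoment.lean` (`RenewalKernelPair.tendsto_Q_div_sq_D`: the second factorial moment `Q(m)/((m+1)²D(m)) → ν²` for any `Q`
with `Q = M∗(Q + 2S)` over the pieces reward pair)).  Lane «pcv-sawmu» (CriticalPhenomena venture), a-p2 g24 — HANDOFF-gen23 item 3 («LLN / concentration
for one long bridge») for the PIECE COUNT (for which no moment hypothesis is needed: one piece = one unit of reward).  Sources of the SETTING / TEMPLATE:
H. Duminil-Copin, A. Hammond, CMP 324 (2013) §2.2 (bridges, renewal points, irreducible bridges — here along the column of the width-`T` honeycomb strip at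
`(x_c, y_T)`); W. Feller I (1968) XIII.3 (recurrent events), XIII.6 (the number of occurrences: mean AND variance), XIII.11; E. Seneta (1973) §6.2.  Nothing
of the kind is printed for the strip; the weak law itself is the textbook Chebyshev step, the input (vanishing variance of the piece density at criticality
for a MATRIX renewal structure with period two) is the lane's.

## What is proved (namespace `Literature.Probability.RandomPlanarGeometry.SAW.HV`; weights `wD T y l = x_c^{|l|−1} y^{#top(l.tail)}`; `N(l) = npieces l` = number
## of irreducible pieces = number of renewal vertices + 1; hat index `n_k = 2k + χ_a − χ_b`, truncation `2k + 1`)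

* §1 ★★ `split_le_phiPieces`, `phiPieces_le_split`, ★★★ `phiPieces_eq_split` — the FIRST-PIECE SPLIT WITH A GENERAL WEIGHT `φ(N) ≥ 0`:
  `Σ_{bridges a→b, σ steps} φ(N)·wD = φ(1)·M_σ(a,b) + Σ_{τ∈[1,σ)} Σ_c M_τ(a,c) · Σ_{bridges c→b, σ−τ steps} φ(N+1)·wD` (`σ ≤ N`, `y ≥ 0`; the tree's
  `pieces_eq_split` is `φ = id`; same bijection `l ↦ (fstP l, xstd (sndP l))`).
* §2 `sum_LUset_eq_zero_of_le`, ★★ `hat_phiPieces_ren` — the hat (parity-class) form `P̂^φ(k) = φ(1)·M̂(k) + Σ_{i+j=k} M̂(i)·P̂^{φ(·+1)}(j)`.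
* §3 ★★ `hat_piecesSq_ren` — with `Q̂(k)_{ab} := Σ_{bridges a→b, n_k steps} N(N−1)·wD`: **`Q̂(k) = Σ_{i+j=k} M̂(i)(Q̂(j) + 2P̂(j))`** (`φ(n) = n(n−1)`:
  `φ(1) = 0`, `φ(n+1) = n(n−1) + 2n`) — the hypothesis `renQ` of the abstract theorem, verbatim.
* §4 (`T ≥ 2`; `u`, `ℓ` ANY positive fixed vectors of `Iinf T y_T`, `ν_T := ⟨ℓ,u⟩/⟨ℓ, M̄_len u⟩`): `hat_piecesSq_facts` (`0 ≤ Q̂ ≤ (2k+3)²D̂`),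
  `tendsto_succ_div_hatLen_half`; ★★★★ `tendsto_piecesSq_per_step_sq` — **`Q̂(k)_{ab}/(n_k² D̂(k)_{ab}) → ν_T²`**;
  ★★★★ `tendsto_pieces_variance` — **`Σ_{bridges a→b, n_k steps} (N − ν_T n_k)²·wD / (n_k² D̂(k)_{ab}) → 0`**: under the critical weighting normalised to a
  probability on the bridges `a → b` with `n` steps, `E[(N/n − ν_T)²] → 0` (quadratic-mean law of large numbers);
  ★★★★ `tendsto_pieces_deviation` — **for every `ε > 0`: `(Σ_{bridges a→b, n_k steps, |N/n_k − ν_T| ≥ ε} wD) / D̂(k)_{ab} → 0`** (Chebyshev): the WEAK LAW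
  — all but a negligible critical weight of the long bridges have `(ν_T ± ε)·n` renewal vertices.  For `T = 2`, `ν₂ = √2 − ½` (#715 «WIDTH-TWO-KERNEL»).

Finite-data face (FIRST-A a-ref-2 g57 and the author, kernel model of `S₂`, 2026-08-27): `Q̂/(n²D̂)` at `(0→0)`, `n = 50/100/200/400`: `0.7812/0.8084/0.8221/0.8289 →
ν₂² = 0.83579`; normalised variance `0.00204/0.00099/0.00049/0.00024` (`Var(N) ≈ 0.098·n`).

Label: LANE THEOREM (own result of lane «pcv-sawmu», a-p2 g24, 2026-08-27); classical template = Feller XIII.6 (mean and variance of the number of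
renewals) + Chebyshev.  NOT claimed: the linear law of the variance (`Var(N)/n → σ_T²`) or a CLT; almost-sure statements (there is no single infinite
bridge here); the contact count (its second moment needs `Σ_j j² m_{ab}(j) y_T^j < ∞`, open for `T ≥ 3`); β-walks; `T = 1`.
-/

noncomputable section

namespace Literature.Probability.RandomPlanarGeometry.SAW

open Finset Filter Topology Matrix BigOperators
open Literature.Analysis.Matrix Literature.Probability.Process

namespace HV

variable {T N : ℕ} {y : ℝ} {σ : ℤ}

/-! ### §1 The `φ`-weighted first-piece split: `P^φ_σ = φ(1)·M_σ + Σ_τ M_τ · P^{φ(·+1)}_{σ−τ}` -/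

section Split

/-- ★★ **Gluing direction of the `φ`-weighted piece split** (`σ ≤ N`, `y ≥ 0`, `φ ≥ 0`): gluing an irreducible first piece to a bridge with `k` pieces gives a
bridge with `k + 1` pieces (`npieces_sndP`), injectively (the tree's `split_le_pieces` with the weight `φ(npieces)·wD`).
[cite: DuminilCopinHammond2013, §2.2 (unique decomposition at renewal points); lane «pcv-sawmu» a-p2 g24 — own] -/
theorem split_le_phiPieces (φ : ℕ → ℝ) (hφ : ∀ n, 0 ≤ φ n) (hy : 0 ≤ y) (hσN : σ ≤ N) (a b : Fin (2 * T)) :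
    φ 1 * LMM T N σ y a b + (∑ τ ∈ Finset.Ico (1 : ℤ) σ, LMM T N τ y *
        (Matrix.of fun c d : Fin (2 * T) =>
          ∑ l ∈ LUset T N (σ - τ) (c : ℕ) (d : ℕ), φ (npieces l + 1) * wD T y l)) a b ≤
      ∑ l ∈ LUset T N σ (a : ℕ) (b : ℕ), φ (npieces l) * wD T y l := by
  classical
  set S := LUset T N σ (a : ℕ) (b : ℕ) with hS
  set Sirr := S.filter fun l => renIdxs l = ∅ with hSirr
  set Sred := S.filter fun l => renIdxs l ≠ ∅ with hSred
  have hψ0 : ∀ l : List HV, 0 ≤ φ (npieces l) * wD T y l := fun l => mul_nonneg (hφ _) (wD_nonneg T hy _)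
  -- (1) irreducible part: `LMset ⊆ Sirr`, and there `npieces = 1`
  have hirr : φ 1 * LMM T N σ y a b ≤ ∑ l ∈ Sirr, φ (npieces l) * wD T y l := by
    rw [LMM, LMs, mul_sum]
    calc ∑ l ∈ LMset T N σ (a : ℕ) (b : ℕ), φ 1 * wD T y l = ∑ l ∈ LMset T N σ (a : ℕ) (b : ℕ), φ (npieces l) * wD T y l := by
          refine sum_congr rfl fun l hl => ?_
          obtain ⟨-, -, -, -, -, -, hren, -⟩ := of_mem_LMset hl
          rw [npieces, hren, Finset.card_empty, zero_add]
      _ ≤ ∑ l ∈ Sirr, φ (npieces l) * wD T y l := by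
          refine sum_le_sum_of_subset_of_nonneg (fun l hl => ?_) fun _ _ _ => hψ0 _
          have hl' := hl
          rw [LMset, mem_filter, HBk, mem_filter] at hl
          obtain ⟨⟨hb, h2, hnp, ha, hb'⟩, hsz⟩ := hl
          obtain ⟨-, -, -, -, -, -, hren, -⟩ := of_mem_LMset hl'
          rw [hSirr, mem_filter, hS, LUset, mem_filter, HBab, mem_filter]
          exact ⟨⟨⟨hb, h2, ha, hb'⟩, hsz⟩, hren⟩
  -- (2) the reducible part
  set tgt : Finset (List HV × List HV) := (Finset.univ : Finset (Fin (2 * T))).biUnion fun c =>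
    (Finset.Ico (1 : ℤ) σ).biUnion fun τ => LMset T N τ (a : ℕ) (c : ℕ) ×ˢ LUset T N (σ - τ) (c : ℕ) (b : ℕ) with htgt
  have hmem_tgt : ∀ pq ∈ tgt, ∃ (c : Fin (2 * T)) (τ : ℤ), τ ∈ Finset.Ico (1 : ℤ) σ ∧
      pq.1 ∈ LMset T N τ (a : ℕ) (c : ℕ) ∧ pq.2 ∈ LUset T N (σ - τ) (c : ℕ) (b : ℕ) := by
    intro pq hpq
    rw [htgt, mem_biUnion] at hpq
    obtain ⟨c, -, hpq⟩ := hpq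
    rw [mem_biUnion] at hpq
    obtain ⟨τ, hτ, hpq⟩ := hpq
    rw [mem_product] at hpq
    exact ⟨c, τ, hτ, hpq.1, hpq.2⟩
  have hglue : ∀ pq ∈ tgt, hcat pq.1 pq.2 ∈ Sred ∧ fstP (hcat pq.1 pq.2) = pq.1 ∧
      sndP (hcat pq.1 pq.2) = pq.2.map (shift (pq.1.getLast?.getD hvOrigin).1 0) ∧
      wD T y (hcat pq.1 pq.2) = wD T y pq.1 * wD T y pq.2 ∧ npieces (hcat pq.1 pq.2) = npieces pq.2 + 1 := by
    intro pq hpq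
    obtain ⟨c, τ, hτ, h1, h2⟩ := hmem_tgt pq hpq
    obtain ⟨hmem, hren, hfst, hsnd, hw⟩ := hcat_mem_LUset (y := y) h1 h2 (by rw [Finset.mem_Ico] at hτ; omega)
    refine ⟨?_, hfst, hsnd, hw, ?_⟩
    · rw [hSred, mem_filter, hS]
      rw [show τ + (σ - τ) = σ by ring] at hmem
      exact ⟨hmem, Finset.nonempty_iff_ne_empty.1 hren⟩
    · rw [← npieces_sndP hren, hsnd, npieces_map_shift]
  have hinj : Set.InjOn (fun pq : List HV × List HV => hcat pq.1 pq.2) (tgt : Set (List HV × List HV)) := by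
    rintro ⟨p, q⟩ hpq ⟨p', q'⟩ hpq' heq
    obtain ⟨-, hf, hs, -⟩ := hglue _ hpq
    obtain ⟨-, hf', hs', -⟩ := hglue _ hpq'
    simp only at heq hf hs hf' hs'
    have hp : p = p' := by rw [← hf, ← hf', heq]
    subst hp
    have hq : q.map (shift (p.getLast?.getD hvOrigin).1 0) = q'.map (shift (p.getLast?.getD hvOrigin).1 0) := by
      rw [← hs, ← hs', heq]
    exact Prod.ext rfl ((List.map_injective_iff.2 (shift _ 0).injective) hq)
  -- bookkeeping: the sum over `tgt` of `wD p · (1 + npieces q) · wD q`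
  have htgt_sum : ∑ pq ∈ tgt, wD T y pq.1 * (φ (npieces pq.2 + 1) * wD T y pq.2) =
      (∑ τ ∈ Finset.Ico (1 : ℤ) σ, LMM T N τ y *
        (Matrix.of fun c d : Fin (2 * T) =>
          ∑ l ∈ LUset T N (σ - τ) (c : ℕ) (d : ℕ), φ (npieces l + 1) * wD T y l)) a b := by
    rw [Matrix.sum_apply, htgt, sum_biUnion]
    · have inner : ∀ c : Fin (2 * T), ∑ pq ∈ (Finset.Ico (1 : ℤ) σ).biUnion (fun τ =>
          LMset T N τ (a : ℕ) (c : ℕ) ×ˢ LUset T N (σ - τ) (c : ℕ) (b : ℕ)), wD T y pq.1 * (φ (npieces pq.2 + 1) * wD T y pq.2) =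
          ∑ τ ∈ Finset.Ico (1 : ℤ) σ, LMs T N τ (a : ℕ) (c : ℕ) y *
            (∑ l ∈ LUset T N (σ - τ) (c : ℕ) (b : ℕ), φ (npieces l + 1) * wD T y l) := by
        intro c
        rw [sum_biUnion]
        · refine sum_congr rfl fun τ _ => ?_
          rw [sum_product, LMs, sum_mul_sum]
        · intro i _ i' _ hne
          rw [Function.onFun, disjoint_left]
          intro pq h1 h2
          rw [mem_product, LMset, mem_filter] at h1 h2
          exact hne (h1.1.2.symm.trans h2.1.2)
      simp_rw [inner]
      rw [sum_comm]
      refine sum_congr rfl fun τ _ => ?_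
      rw [Matrix.mul_apply]
      refine sum_congr rfl fun c _ => ?_
      rw [Matrix.of_apply]
      rfl
    · intro c _ c' _ hcc'
      rw [Function.onFun, disjoint_left]
      intro pq h1 h2
      rw [mem_biUnion] at h1 h2
      obtain ⟨i, -, h1⟩ := h1
      obtain ⟨i', -, h2⟩ := h2
      rw [mem_product, LMset, mem_filter, HBk, mem_filter] at h1 h2
      have e1 := h1.1.1.2.2.2.2; have e2 := h2.1.1.2.2.2.2
      exact hcc' (Fin.ext (by have := e1.symm.trans e2; exact_mod_cast this))
  have hred : (∑ τ ∈ Finset.Ico (1 : ℤ) σ, LMM T N τ y *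
        (Matrix.of fun c d : Fin (2 * T) =>
          ∑ l ∈ LUset T N (σ - τ) (c : ℕ) (d : ℕ), φ (npieces l + 1) * wD T y l)) a b ≤
      ∑ l ∈ Sred, φ (npieces l) * wD T y l := by
    rw [← htgt_sum]
    calc ∑ pq ∈ tgt, wD T y pq.1 * (φ (npieces pq.2 + 1) * wD T y pq.2)
        = ∑ pq ∈ tgt, φ (npieces (hcat pq.1 pq.2)) * wD T y (hcat pq.1 pq.2) := by
          refine sum_congr rfl fun pq hpq => ?_
          obtain ⟨-, -, -, hw, hnp⟩ := hglue pq hpq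
          rw [hw, hnp]; ring
      _ = ∑ l ∈ tgt.image (fun pq => hcat pq.1 pq.2), φ (npieces l) * wD T y l := by rw [sum_image hinj]
      _ ≤ ∑ l ∈ Sred, φ (npieces l) * wD T y l := by
          refine sum_le_sum_of_subset_of_nonneg (fun l hl => ?_) fun _ _ _ => hψ0 _
          rw [mem_image] at hl
          obtain ⟨pq, hpq, rfl⟩ := hl
          exact (hglue pq hpq).1
  have hsplitS : ∑ l ∈ S, φ (npieces l) * wD T y l =
      ∑ l ∈ Sirr, φ (npieces l) * wD T y l + ∑ l ∈ Sred, φ (npieces l) * wD T y l := by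
    rw [hSirr, hSred, ← sum_filter_add_sum_filter_not S (fun l => renIdxs l = ∅)]
  rw [hsplitS]
  exact add_le_add hirr hred

/-- ★★ **Splitting direction of the `φ`-weighted piece split** (`y ≥ 0`, `φ ≥ 0`): a bridge with `k + 1 ≥ 2` pieces splits at its first renewal vertex into an
irreducible piece and a bridge with `k` pieces (`npieces_sndP`), injectively (the tree's `pieces_le_split` with the weight `φ(npieces)·wD`).
[cite: DuminilCopinHammond2013, §2.2; lane «pcv-sawmu» a-p2 g24 — own] -/
theorem phiPieces_le_split (φ : ℕ → ℝ) (hφ : ∀ n, 0 ≤ φ n) (hy : 0 ≤ y) (σ : ℤ) (a b : Fin (2 * T)) :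
    (∑ l ∈ LUset T N σ (a : ℕ) (b : ℕ), φ (npieces l) * wD T y l) ≤
      φ 1 * LMM T N σ y a b + (∑ τ ∈ Finset.Ico (1 : ℤ) σ, LMM T N τ y *
        (Matrix.of fun c d : Fin (2 * T) =>
          ∑ l ∈ LUset T N (σ - τ) (c : ℕ) (d : ℕ), φ (npieces l + 1) * wD T y l)) a b := by
  classical
  set S := LUset T N σ (a : ℕ) (b : ℕ) with hS
  set Sirr := S.filter fun l => renIdxs l = ∅ with hSirr
  set Sred := S.filter fun l => renIdxs l ≠ ∅ with hSred
  have hmemS : ∀ l ∈ S, l.IsChain hvGraph.Adj ∧ l.Nodup ∧ l.length ≤ N + 1 ∧ (∃ v, l.head? = some v ∧ v.1 = 0) ∧ InLev T l ∧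
      IsHBridge l ∧ 2 ≤ l.length ∧ hdLev l = a ∧ ltLev l = b ∧ hlen l = σ := by
    intro l hl
    rw [hS, LUset, mem_filter, HBab, mem_filter, mem_hBridgesN_iff] at hl
    obtain ⟨⟨⟨hc, hnd, hlenN, hh, hin, hB⟩, h2, ha, hb⟩, hsz⟩ := hl
    exact ⟨hc, hnd, hlenN, hh, hin, hB, h2, ha, hb, hsz⟩
  -- (1) the irreducible part (`npieces = 1` there)
  have hirr : ∑ l ∈ Sirr, φ (npieces l) * wD T y l ≤ φ 1 * LMM T N σ y a b := by
    rw [LMM, LMs, mul_sum]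
    calc ∑ l ∈ Sirr, φ (npieces l) * wD T y l = ∑ l ∈ Sirr, φ 1 * wD T y l := by
          refine sum_congr rfl fun l hl => ?_
          rw [hSirr, mem_filter] at hl
          rw [npieces, hl.2, Finset.card_empty, zero_add]
      _ ≤ _ := by
          refine sum_le_sum_of_subset_of_nonneg (fun l hl => ?_) fun _ _ _ => mul_nonneg (hφ 1) (wD_nonneg T hy _)
          rw [hSirr, mem_filter] at hl
          obtain ⟨hl, hren⟩ := hl
          obtain ⟨hc, hnd, hlenN, hh, hin, hB, h2, ha, hb, hsz⟩ := hmemS l hl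
          rw [LMset, mem_filter, HBk, mem_filter]
          exact ⟨⟨mem_hBridgesN_iff.2 ⟨hc, hnd, hlenN, hh, hin, hB⟩, h2, by rw [npieces, hren]; rfl, ha, hb⟩, hsz⟩
  -- (2) the reducible part: the split map into the double union
  set tgt : Finset (List HV × List HV) := (Finset.univ : Finset (Fin (2 * T))).biUnion fun c =>
    (Finset.Ico (1 : ℤ) σ).biUnion fun τ => LMset T N τ (a : ℕ) (c : ℕ) ×ˢ LUset T N (σ - τ) (c : ℕ) (b : ℕ) with htgt
  have himg : ∀ l ∈ Sred, (fstP l, xstd (sndP l)) ∈ tgt := by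
    intro l hl
    rw [hSred, mem_filter] at hl
    obtain ⟨hl, hren'⟩ := hl
    have hren : (renIdxs l).Nonempty := Finset.nonempty_iff_ne_empty.2 hren'
    obtain ⟨hc, hnd, hlenN, ⟨v, hv, hv0⟩, hin, hB, h2, ha, hb, hsz⟩ := hmemS l hl
    have hlens := length_fstP_sndP hren
    obtain ⟨hB1, hB2⟩ := isHBridge_fstP_sndP hB hren
    obtain ⟨e1, e2, e3, e4⟩ := fstP_sndP_ends hren
    obtain ⟨hne1, hne2⟩ := fstP_sndP_ne_nil hren
    have hl0 : l ≠ [] := by rintro rfl; simp at h2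
    have hspl := hlen_split hren
    have hf := (fIdx_spec hren).1
    have hlen1 : 2 ≤ (fstP l).length := by rw [fstP, List.length_take]; have := hf.1; have := hf.2.1; omega
    have hlen2 : 2 ≤ (sndP l).length := by rw [sndP, List.length_drop]; have := hf.2.1; omega
    have hτ1 : 1 ≤ hlen (fstP l) := one_le_hlen_of_two_le hB1 hlen1
    have hτ2 : 1 ≤ hlen (sndP l) := one_le_hlen_of_two_le hB2 hlen2
    set cz : ℤ := lev (l[fIdx l]'(by have := (fIdx_spec hren).1.2.1; omega)) with hcz
    have hcz0 : 0 ≤ cz ∧ cz ≤ 2 * (T : ℤ) - 1 := hin _ (List.getElem_mem _)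
    let c : Fin (2 * T) := ⟨cz.toNat, by omega⟩
    have hcc : ((c : ℕ) : ℤ) = cz := by simp [c]; omega
    rw [htgt, mem_biUnion]
    refine ⟨c, mem_univ _, ?_⟩
    rw [mem_biUnion]
    refine ⟨hlen (fstP l), Finset.mem_Ico.2 ⟨hτ1, by omega⟩, mem_product.2 ⟨?_, ?_⟩⟩
    · show fstP l ∈ LMset T N _ _ _
      rw [LMset, mem_filter, HBk, mem_filter, mem_hBridgesN_iff]
      refine ⟨⟨⟨hc.take _, hnd.sublist (List.take_sublist _ _), by omega, ⟨v, ?_, hv0⟩,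
        fun w hw => hin w ((List.take_sublist _ _).subset hw), hB1⟩, hlen1, by rw [npieces, renIdxs_fstP hren]; rfl, ?_, ?_⟩, rfl⟩
      · rw [fstP, List.head?_take, if_neg (by omega), hv]
      · rw [hdLev, fstP, List.head?_take, if_neg (by omega)]; rw [hdLev] at ha; exact ha
      · rw [ltLev, List.getLast?_eq_some_getLast hne1, Option.getD_some, e2, hcc]
    · show xstd (sndP l) ∈ LUset T N _ _ _
      rw [LUset, mem_filter, HBab, mem_filter, mem_hBridgesN_iff]
      have hv2 : (sndP l).head? = some (l[fIdx l]'(by have := (fIdx_spec hren).1.2.1; omega)) := by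
        rw [List.head?_eq_some_head hne2, e3]
      refine ⟨⟨⟨isChain_xstd (hc.drop _), nodup_xstd (hnd.sublist (List.drop_sublist _ _)), by rw [length_xstd]; omega,
        ⟨_, head?_xstd hv2, rfl⟩, inLev_xstd fun w hw => hin w ((List.drop_sublist _ _).subset hw), isHBridge_xstd hB2⟩,
        by rw [length_xstd]; exact hlen2, ?_, ?_⟩, by rw [hlen_xstd]; omega⟩
      · rw [hdLev, head?_xstd hv2, Option.getD_some, hcc, hcz]; simp [lev, bit]
      · rw [ltLev, xstd, List.getLast?_map, List.getLast?_eq_some_getLast hne2, Option.map_some, Option.getD_some, lev_shift_zero, e4]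
        rw [ltLev, List.getLast?_eq_some_getLast hl0, Option.getD_some] at hb; exact hb
  have hinj : Set.InjOn (fun l : List HV => (fstP l, xstd (sndP l))) (Sred : Set (List HV)) := by
    intro l hl l' hl' h
    rw [mem_coe, hSred, mem_filter] at hl hl'
    exact split_injOn (Finset.nonempty_iff_ne_empty.2 hl.2) (Finset.nonempty_iff_ne_empty.2 hl'.2) h
  have hred : ∑ l ∈ Sred, φ (npieces l) * wD T y l ≤ (∑ τ ∈ Finset.Ico (1 : ℤ) σ, LMM T N τ y *
        (Matrix.of fun c d : Fin (2 * T) =>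
          ∑ l ∈ LUset T N (σ - τ) (c : ℕ) (d : ℕ), φ (npieces l + 1) * wD T y l)) a b := by
    calc ∑ l ∈ Sred, φ (npieces l) * wD T y l
        = ∑ l ∈ Sred, wD T y (fstP l) * (φ (npieces (xstd (sndP l)) + 1) * wD T y (xstd (sndP l))) := by
          refine sum_congr rfl fun l hl => ?_
          rw [hSred, mem_filter] at hl
          have hren := Finset.nonempty_iff_ne_empty.2 hl.2
          rw [wD_eq_mul_fstP_sndP T y hren, npieces_xstd, ← npieces_sndP hren]
          have : wD T y (xstd (sndP l)) = wD T y (sndP l) := by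
            rw [wD, wD, length_xstd, xstd, ← List.map_tail, topCnt_map_shift]
          rw [this]; ring
      _ = ∑ pq ∈ Sred.image fun l => (fstP l, xstd (sndP l)), wD T y pq.1 * (φ (npieces pq.2 + 1) * wD T y pq.2) := by
          rw [sum_image hinj]
      _ ≤ ∑ pq ∈ tgt, wD T y pq.1 * (φ (npieces pq.2 + 1) * wD T y pq.2) := by
          refine sum_le_sum_of_subset_of_nonneg (fun pq hpq => ?_)
            fun pq _ _ => mul_nonneg (wD_nonneg T hy _) (mul_nonneg (hφ _) (wD_nonneg T hy _))
          rw [mem_image] at hpq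
          obtain ⟨l, hl, rfl⟩ := hpq
          exact himg l hl
      _ = _ := by
          rw [Matrix.sum_apply, htgt, sum_biUnion]
          · have inner : ∀ c : Fin (2 * T), ∑ pq ∈ (Finset.Ico (1 : ℤ) σ).biUnion (fun τ =>
                LMset T N τ (a : ℕ) (c : ℕ) ×ˢ LUset T N (σ - τ) (c : ℕ) (b : ℕ)), wD T y pq.1 * (φ (npieces pq.2 + 1) * wD T y pq.2) =
                ∑ τ ∈ Finset.Ico (1 : ℤ) σ, LMs T N τ (a : ℕ) (c : ℕ) y *
                  (∑ l ∈ LUset T N (σ - τ) (c : ℕ) (b : ℕ), φ (npieces l + 1) * wD T y l) := by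
              intro c
              rw [sum_biUnion]
              · refine sum_congr rfl fun τ _ => ?_
                rw [sum_product, LMs, sum_mul_sum]
              · intro i _ i' _ hne
                rw [Function.onFun, disjoint_left]
                intro pq h1 h2
                rw [mem_product, LMset, mem_filter] at h1 h2
                exact hne (h1.1.2.symm.trans h2.1.2)
            simp_rw [inner]
            rw [sum_comm]
            refine sum_congr rfl fun τ _ => ?_
            rw [Matrix.mul_apply]
            refine sum_congr rfl fun c _ => ?_
            rw [Matrix.of_apply]
            rfl
          · intro c _ c' _ hcc'
            rw [Function.onFun, disjoint_left]
            intro pq h1 h2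
            rw [mem_biUnion] at h1 h2
            obtain ⟨i, -, h1⟩ := h1
            obtain ⟨i', -, h2⟩ := h2
            rw [mem_product, LMset, mem_filter, HBk, mem_filter] at h1 h2
            have e1 := h1.1.1.2.2.2.2; have e2 := h2.1.1.2.2.2.2
            exact hcc' (Fin.ext (by have := e1.symm.trans e2; exact_mod_cast this))
  have hsplitS : ∑ l ∈ S, φ (npieces l) * wD T y l =
      ∑ l ∈ Sirr, φ (npieces l) * wD T y l + ∑ l ∈ Sred, φ (npieces l) * wD T y l := by
    rw [hSirr, hSred, ← sum_filter_add_sum_filter_not S (fun l => renIdxs l = ∅)]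
  rw [hsplitS]
  exact add_le_add hirr hred

/-- ★★★ **THE `φ`-WEIGHTED PIECE SPLIT IS EXACT** (`σ ≤ N`, `y ≥ 0`, `φ ≥ 0`): with `P^φ_σ(a,b) := Σ_{bridges a→b with σ steps} φ(npieces)·x_c^σ y^{#top}`,
`P^φ_σ(a,b) = φ(1)·M_σ(a,b) + Σ_{τ∈[1,σ)} Σ_c M_τ(a,c)·P^{φ(·+1)}_{σ−τ}(c,b)` — the number of pieces is one more than that of the remainder after the first renewal
vertex (`φ = id` is the tree's `pieces_eq_split`; `φ(n) = n(n−1)` gives the second factorial moment below). [cite: DuminilCopinHammond2013, §2.2; Feller1968, XIII.3; lane «pcv-sawmu» a-p2 g24 — own] -/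
theorem phiPieces_eq_split (φ : ℕ → ℝ) (hφ : ∀ n, 0 ≤ φ n) (hy : 0 ≤ y) (hσN : σ ≤ N) (a b : Fin (2 * T)) :
    (∑ l ∈ LUset T N σ (a : ℕ) (b : ℕ), φ (npieces l) * wD T y l) =
      φ 1 * LMM T N σ y a b + (∑ τ ∈ Finset.Ico (1 : ℤ) σ, LMM T N τ y *
        (Matrix.of fun c d : Fin (2 * T) =>
          ∑ l ∈ LUset T N (σ - τ) (c : ℕ) (d : ℕ), φ (npieces l + 1) * wD T y l)) a b :=
  le_antisymm (phiPieces_le_split φ hφ hy σ a b) (split_le_phiPieces φ hφ hy hσN a b)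

end Split

/-! ### §2 The hat (parity-class) form of the `φ`-weighted split -/

section Hat

/-- A length slice with `σ ≤ 0` is empty, so any weighted sum over it vanishes (plumbing). [cite: DuminilCopinHammond2013, §2.2; lane plumbing a-p2 g24] -/
theorem sum_LUset_eq_zero_of_le (hσ : σ ≤ 0) {N : ℕ} {a b : ℤ} (w : List HV → ℝ) :
    (∑ l ∈ LUset T N σ a b, w l) = 0 := by
  refine sum_eq_zero fun l hl => ?_
  exfalso
  obtain ⟨-, -, -, -, -, -, h2, -, -, hsz⟩ := of_mem_LUset hl
  unfold hlen at hsz; omega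

/-- ★★ **The `φ`-weighted split along the parity classes**: with `P̂^φ(k)_{ab} := P^φ_{2k+χ_a−χ_b}(a,b)` (truncation `2k+1`),
`P̂^φ(k) = φ(1)·M̂(k) + Σ_{i+j=k} M̂(i)·P̂^{φ(·+1)}(j)` for every `y ≥ 0` (the regrouping of the tree's `hat_pieces_ren`, general weight).
[cite: Feller1968, XIII.3 (periodic renewal sequences); DuminilCopinHammond2013, §2.2; lane «pcv-sawmu» a-p2 g24 — own] -/
theorem hat_phiPieces_ren (φ : ℕ → ℝ) (hφ : ∀ n, 0 ≤ φ n) (hy : 0 ≤ y) (k : ℕ) :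
    (Matrix.of fun a b : Fin (2 * T) => ∑ l ∈ LUset T (2 * k + 1) (hatLen k a b) (a : ℕ) (b : ℕ), φ (npieces l) * wD T y l) =
      φ 1 • hatM T y k + ∑ p ∈ antidiagonal k, hatM T y p.1 *
        (Matrix.of fun a b : Fin (2 * T) =>
          ∑ l ∈ LUset T (2 * p.2 + 1) (hatLen p.2 a b) (a : ℕ) (b : ℕ), φ (npieces l + 1) * wD T y l) := by
  ext a b
  have hχa := (lchi_facts a).1; have hχb := (lchi_facts b).1
  set σ : ℤ := hatLen k a b with hσdef
  have hσN : σ ≤ ((2 * k + 1 : ℕ) : ℤ) := by rw [hσdef]; unfold hatLen; push_cast; omega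
  rw [Matrix.add_apply, Matrix.of_apply, phiPieces_eq_split φ hφ hy hσN a b, Matrix.smul_apply, smul_eq_mul,
    show LMM T (2 * k + 1) σ y a b = hatM T y k a b from rfl]
  congr 1
  rw [Matrix.sum_apply, Matrix.sum_apply]
  simp only [Matrix.mul_apply]
  rw [sum_comm, sum_comm (s := antidiagonal k)]
  refine sum_congr rfl fun c _ => ?_
  have hχc := (lchi_facts c).1
  -- for the fixed middle level `c`: both sides are sums of `f τ := M_τ(a,c) (U + P)_{σ−τ}(c,b)` (truncation `2k+1`)
  set f : ℤ → ℝ := fun τ => LMM T (2 * k + 1) τ y a c *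
    (∑ l ∈ LUset T (2 * k + 1) (σ - τ) (c : ℕ) (b : ℕ), φ (npieces l + 1) * wD T y l) with hfdef
  set δ₁ : ℤ := lchi a - lchi c with hδ₁
  -- right side, rewritten with truncation `2k+1` and as an image sum
  have hR : ∑ p ∈ antidiagonal k, hatM T y p.1 a c * (Matrix.of fun a b : Fin (2 * T) =>
      ∑ l ∈ LUset T (2 * p.2 + 1) (hatLen p.2 a b) (a : ℕ) (b : ℕ), φ (npieces l + 1) * wD T y l) c b =
      ∑ i ∈ range (k + 1), f (2 * (i : ℤ) + δ₁) := by
    rw [Nat.sum_antidiagonal_eq_sum_range_succ_mk]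
    refine sum_congr rfl fun i hi => ?_
    rw [mem_range] at hi
    have hi1 : hatLen i a c ≤ ((2 * k + 1 : ℕ) : ℤ) := by unfold hatLen; push_cast; omega
    have hi2 : hatLen (k - i) c b ≤ ((2 * k + 1 : ℕ) : ℤ) := by unfold hatLen; push_cast; omega
    have hi2' : hatLen (k - i) c b ≤ ((2 * (k - i) + 1 : ℕ) : ℤ) := by unfold hatLen; push_cast; omega
    rw [Matrix.of_apply, ← (hat_trunc i a c hi1).1, LUset_eq_of_le hi2' hi2, hfdef]
    simp only
    have e1 : hatLen i a c = 2 * (i : ℤ) + δ₁ := by rw [hδ₁]; unfold hatLen; ring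
    have e2 : hatLen (k - i) c b = σ - (2 * (i : ℤ) + δ₁) := by
      rw [hσdef, hδ₁]; unfold hatLen; push_cast [Nat.cast_sub (show i ≤ k by omega)]; ring
    rw [e1, e2]
  rw [hR]
  have hinj : Set.InjOn (fun i : ℕ => 2 * (i : ℤ) + δ₁) (range (k + 1) : Finset ℕ) := fun i _ j _ h => by
    simpa using h
  rw [← sum_image hinj]
  set S : Finset ℤ := (range (k + 1)).image (fun i : ℕ => 2 * (i : ℤ) + δ₁) with hSdef
  change ∑ τ ∈ Finset.Ico (1 : ℤ) σ, f τ = ∑ τ ∈ S, f τ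
  have hvan1 : ∀ τ ∈ S, τ ∉ Finset.Ico (1 : ℤ) σ → f τ = 0 := by
    intro τ hτ hτI
    rw [hSdef, mem_image] at hτ
    obtain ⟨i, hi, rfl⟩ := hτ
    rw [mem_range] at hi
    rw [Finset.mem_Ico, not_and_or, not_le, not_lt] at hτI
    rw [hfdef]; simp only
    rcases hτI with h0 | h0
    · rw [LMM_eq_zero_of_le (by omega), zero_mul]
    · rw [sum_LUset_eq_zero_of_le (by omega), mul_zero]
  have hvan2 : ∀ τ ∈ Finset.Ico (1 : ℤ) σ, τ ∉ S → f τ = 0 := by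
    intro τ hτI hτ
    rw [Finset.mem_Ico] at hτI
    rw [hfdef]; simp only
    have hpar : ¬ Even (τ + (a : ℕ) + (c : ℕ)) := by
      rintro ⟨m, hm⟩
      apply hτ
      obtain ⟨ja, hja⟩ := (lchi_facts a).2
      obtain ⟨jc, hjc⟩ := (lchi_facts c).2
      have hσ' : σ = 2 * (k : ℤ) + lchi a - lchi b := by rw [hσdef]; unfold hatLen; ring
      rw [hSdef, mem_image]
      exact ⟨((τ - δ₁) / 2).toNat, mem_range.2 (by omega), (by omega : 2 * ((((τ - δ₁) / 2).toNat : ℕ) : ℤ) + δ₁ = τ)⟩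
    rw [(LUM_LMM_eq_zero_of_not_even y a c hpar).2, zero_mul]
  have e1 : ∑ τ ∈ Finset.Ico (1 : ℤ) σ ∩ S, f τ = ∑ τ ∈ Finset.Ico (1 : ℤ) σ, f τ :=
    sum_subset inter_subset_left fun τ hτI hτn => hvan2 τ hτI fun hτS => hτn (mem_inter.2 ⟨hτI, hτS⟩)
  have e2 : ∑ τ ∈ Finset.Ico (1 : ℤ) σ ∩ S, f τ = ∑ τ ∈ S, f τ :=
    sum_subset inter_subset_right fun τ hτS hτn => hvan1 τ hτS fun hτI => hτn (mem_inter.2 ⟨hτI, hτS⟩)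
  rw [← e1, e2]

end Hat

/-! ### §3 The second factorial moment of the piece count: `Q̂(k) = Σ_{i+j=k} M̂(i)(Q̂(j) + 2P̂(j))` -/

section SecondMoment

/-- `n(n − 1) ≥ 0` on `ℕ` (plumbing; `private`: a statement-twin exists in an unrelated Literature corner). [cite: Feller1968, XIII.6; lane plumbing a-p2 g24] -/
private theorem natMulPred_nonneg (n : ℕ) : 0 ≤ (n : ℝ) * ((n : ℝ) - 1) := by
  rcases n with _ | n
  · simp
  · push_cast
    nlinarith

/-- ★★ **THE `Q`-RECURSION OF THE STRIP** (`y ≥ 0`): with `P̂(k)_{ab} := Σ_{bridges a→b, n_k steps} npieces·wD` and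
`Q̂(k)_{ab} := Σ_{bridges a→b, n_k steps} npieces·(npieces − 1)·wD` (`n_k = 2k + χ_a − χ_b`, truncation `2k+1`),
`Q̂(k) = Σ_{i+j=k} M̂(i)·(Q̂(j) + 2P̂(j))` — the `φ`-split for `φ(n) = n(n−1)`: `φ(1) = 0` and `φ(n+1) = n(n−1) + 2n`.
[cite: Feller1968, XIII.6 (moments of the number of renewals by the renewal argument); DuminilCopinHammond2013, §2.2; lane «pcv-sawmu» a-p2 g24 — own] -/
theorem hat_piecesSq_ren (hy : 0 ≤ y) (k : ℕ) :
    (Matrix.of fun a b : Fin (2 * T) => ∑ l ∈ LUset T (2 * k + 1) (hatLen k a b) (a : ℕ) (b : ℕ),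
        (npieces l : ℝ) * ((npieces l : ℝ) - 1) * wD T y l) =
      ∑ p ∈ antidiagonal k, hatM T y p.1 *
        ((Matrix.of fun a b : Fin (2 * T) => ∑ l ∈ LUset T (2 * p.2 + 1) (hatLen p.2 a b) (a : ℕ) (b : ℕ),
            (npieces l : ℝ) * ((npieces l : ℝ) - 1) * wD T y l) +
          (2 : ℝ) • (Matrix.of fun a b : Fin (2 * T) => ∑ l ∈ LUset T (2 * p.2 + 1) (hatLen p.2 a b) (a : ℕ) (b : ℕ),
            (npieces l : ℝ) * wD T y l)) := by
  have h := hat_phiPieces_ren (T := T) (fun n : ℕ => (n : ℝ) * ((n : ℝ) - 1)) natMulPred_nonneg hy k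
  simp only [Nat.cast_one, sub_self, mul_zero, zero_smul, zero_add] at h
  rw [h]
  refine sum_congr rfl fun p _ => ?_
  congr 1
  ext a b
  simp only [Matrix.of_apply, Matrix.add_apply, Matrix.smul_apply, smul_eq_mul, mul_sum, ← sum_add_distrib]
  refine sum_congr rfl fun l _ => ?_
  push_cast
  ring

end SecondMoment

/-! ### §4 ★★★★ The second factorial moment per step² tends to `ν_T²`; the variance of the piece density vanishes; the weak law -/

section LLN

variable {u ℓ : Fin (2 * T) → ℝ}

/-- `0 ≤ Q̂(k)_{ab} ≤ (2k+3)² · D̂(k)_{ab}` (a bridge with `n` steps has at most `n + 2` pieces; plumbing). [cite: DuminilCopinHammond2013, §2.2; lane plumbing a-p2 g24] -/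
theorem hat_piecesSq_facts (hy : 0 ≤ y) (k : ℕ) (a b : Fin (2 * T)) :
    0 ≤ ∑ l ∈ LUset T (2 * k + 1) (hatLen k a b) (a : ℕ) (b : ℕ), (npieces l : ℝ) * ((npieces l : ℝ) - 1) * wD T y l ∧
      ∑ l ∈ LUset T (2 * k + 1) (hatLen k a b) (a : ℕ) (b : ℕ), (npieces l : ℝ) * ((npieces l : ℝ) - 1) * wD T y l ≤
        (2 * k + 3) ^ 2 * hatD T y k a b := by
  have h0 : ∀ l : List HV, 0 ≤ (npieces l : ℝ) * ((npieces l : ℝ) - 1) * wD T y l :=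
    fun l => mul_nonneg (natMulPred_nonneg _) (wD_nonneg T hy _)
  refine ⟨sum_nonneg fun l _ => h0 l, ?_⟩
  rw [hatD, LUM, LUs, mul_sum]
  refine sum_le_sum fun l hl => mul_le_mul_of_nonneg_right ?_ (wD_nonneg T hy _)
  obtain ⟨-, -, hlen, -⟩ := of_mem_LUset hl
  have h1 : npieces l ≤ l.length + 1 := by
    rw [npieces, renIdxs]
    have := (range l.length).card_filter_le (fun i => IsRenewalIdx l i)
    rw [Finset.card_range] at this
    omega
  have h2 : (npieces l : ℝ) ≤ (l.length : ℝ) + 1 := by exact_mod_cast h1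
  have h3 : (l.length : ℝ) ≤ 2 * k + 2 := by exact_mod_cast (show l.length ≤ 2 * k + 2 by omega)
  have h4 : (npieces l : ℝ) ≤ 2 * k + 3 := by linarith
  have h5 : 0 ≤ (npieces l : ℝ) := Nat.cast_nonneg _
  nlinarith

/-- `(k+1)/(2k + χ_a − χ_b) → 1/2` (plumbing; the tree's copy is private). [cite: Feller1968, XIII.3; lane plumbing a-p2 g24] -/
theorem tendsto_succ_div_hatLen_half (a b : Fin (2 * T)) :
    Tendsto (fun k : ℕ => ((k : ℝ) + 1) / (hatLen k a b : ℝ)) atTop (𝓝 (1 / 2)) := by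
  set e : ℤ := lchi a - lchi b with he
  have hL : ∀ k : ℕ, (hatLen k a b : ℝ) = 2 * (k : ℝ) + (e : ℝ) := fun k => by unfold hatLen; push_cast; rw [he]; push_cast; ring
  have hden : Tendsto (fun k : ℕ => 2 * (k : ℝ) + (e : ℝ)) atTop atTop :=
    (tendsto_natCast_atTop_atTop.const_mul_atTop two_pos).atTop_add tendsto_const_nhds
  have hsmall : Tendsto (fun k : ℕ => (1 - (e : ℝ) / 2) / (2 * (k : ℝ) + (e : ℝ))) atTop (𝓝 0) :=
    tendsto_const_nhds.div_atTop hden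
  have hlim : Tendsto (fun k : ℕ => 1 / 2 + (1 - (e : ℝ) / 2) / (2 * (k : ℝ) + (e : ℝ))) atTop (𝓝 (1 / 2 + 0)) :=
    tendsto_const_nhds.add hsmall
  rw [add_zero] at hlim
  refine hlim.congr' ?_
  filter_upwards [hden.eventually_gt_atTop 0] with k hk
  rw [hL k]
  field_simp
  ring

/-- ★★★★ **THE SECOND FACTORIAL MOMENT OF THE NUMBER OF RENEWAL PIECES** (`T ≥ 2`).  For all levels `a, b`, along `n_k = 2k + χ_a − χ_b`, with
`Q̂(k)_{ab} = Σ_{bridges a→b, n_k steps} npieces·(npieces − 1)·x_c^{n_k} y_T^{#top}` and `u`, `ℓ` any positive fixed vectors of `Iinf T y_T`: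
`Q̂(k)_{ab} / (n_k² · D̂(k)_{ab}) ⟶ ν_T²`, `ν_T = ⟨ℓ,u⟩/⟨ℓ, M̄_len u⟩`
— by the abstract second-moment theorem `RenewalKernelPair.tendsto_Q_div_sq_D` applied to the pieces reward pair `(M̂, P̂)` of the critical hat pair and the
strip's `Q`-recursion `hat_piecesSq_ren`. [cite: Feller1968, XIII.3, XIII.6 (mean and variance of the number of renewals); DuminilCopinHammond2013, §2.2; lane «pcv-sawmu» a-p2 g24 — own result] -/
theorem tendsto_piecesSq_per_step_sq (hT : 2 ≤ T) (hu0 : ∀ a, 0 < u a) (hℓ0 : ∀ b, 0 < ℓ b)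
    (hu : Iinf T (stripYT T) *ᵥ u = u) (hℓ : ℓ ᵥ* Iinf T (stripYT T) = ℓ) (a b : Fin (2 * T)) :
    Tendsto (fun k : ℕ => (∑ l ∈ LUset T (2 * k + 1) (hatLen k a b) (a : ℕ) (b : ℕ),
          (npieces l : ℝ) * ((npieces l : ℝ) - 1) * wD T (stripYT T) l) /
        ((hatLen k a b : ℝ) ^ 2 * hatD T (stripYT T) k a b)) atTop
      (𝓝 (((ℓ ⬝ᵥ u) / (ℓ ⬝ᵥ ((Matrix.of fun a b : Fin (2 * T) => ∑' n : ℕ, (n : ℝ) * LMM T n (n : ℤ) (stripYT T) a b) *ᵥ u))) ^ 2)) := by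
  have hT1 : 1 ≤ T := by omega
  have hyT : 0 < stripYT T := stripYT_pos hT1
  obtain ⟨hl, hL⟩ := tendsto_stripLenD_residue_explicit hT hu0 hℓ0 hu hℓ
  set dl := ℓ ⬝ᵥ ((Matrix.of fun a b : Fin (2 * T) => ∑' n : ℕ, (n : ℝ) * LMM T n (n : ℤ) (stripYT T) a b) *ᵥ u) with hdl
  have hres : ∀ a b, Tendsto (fun s : ℝ => (1 - s) * stripLenD T s a b) (𝓝[<] 1) (𝓝 (1 / dl * (u a * ℓ b))) := fun a b => by
    have := hL a b; rwa [show u a * ℓ b / dl = 1 / dl * (u a * ℓ b) by ring] at this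
  have hcrit := hatPair_critical hT hu0 hℓ0 (one_div_pos.2 hl) hres
  set K := hatPair T hyT.le with hK
  -- the pieces reward pair `(M̂, P̂)` (as in the tree's `tendsto_hat_pieces_div`)
  let W : RenewalKernelPair.RewardPair K :=
    { R := hatM T (stripYT T)
      S := fun k => Matrix.of fun a b : Fin (2 * T) =>
        ∑ l ∈ LUset T (2 * k + 1) (hatLen k a b) (a : ℕ) (b : ℕ), (npieces l : ℝ) * wD T (stripYT T) l
      R_nonneg := fun k a b => (LMM_LUM_nonneg hyT.le _ a b).1
      S_nonneg := fun k a b => (hat_pieces_facts hyT.le k a b).1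
      ren := fun k => by
        rw [hat_pieces_ren hyT.le k]
        congr 1
        refine sum_congr rfl fun p _ => ?_
        rw [Matrix.mul_add]
        rfl
      summable_R := fun a b => hcrit.summable_M a b
      summable_S := fun a b s hs0 hs1 => by
        obtain ⟨B, hB⟩ := (K.tendsto_coeff hcrit a b).bddAbove_range
        have hB' : ∀ k, hatD T (stripYT T) k a b ≤ B := fun k => hB ⟨k, rfl⟩
        have hB0 : 0 ≤ B := (LMM_LUM_nonneg hyT.le _ a b).2.trans (hB' 0)
        have hg : Summable fun k : ℕ => (2 * k + 3) * B * s ^ k := by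
          have h1 : Summable fun k : ℕ => (k : ℝ) * s ^ k := by
            have := summable_pow_mul_geometric_of_norm_lt_one 1 (show ‖s‖ < 1 by rw [Real.norm_eq_abs, abs_of_nonneg hs0]; exact hs1)
            simpa using this
          have h2 : Summable fun k : ℕ => s ^ k := summable_geometric_of_lt_one hs0 hs1
          have : (fun k : ℕ => (2 * k + 3) * B * s ^ k) = fun k : ℕ => 2 * B * ((k : ℝ) * s ^ k) + 3 * B * s ^ k := by
            funext k; ring
          rw [this]
          exact (h1.mul_left _).add (h2.mul_left _)
        refine hg.of_nonneg_of_le (fun k => mul_nonneg (hat_pieces_facts hyT.le k a b).1 (pow_nonneg hs0 _)) fun k => ?_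
        simp only [Matrix.of_apply]
        refine mul_le_mul_of_nonneg_right ?_ (pow_nonneg hs0 _)
        exact (hat_pieces_facts hyT.le k a b).2.trans (mul_le_mul_of_nonneg_left (hB' k) (by positivity)) }
  have hRM : ∀ j, W.R j = K.M j := fun j => rfl
  -- the `Q`-recursion of the strip is the abstract one over `K`
  have hQ := RenewalKernelPair.tendsto_Q_div_sq_D hcrit W hRM
    (fun k => Matrix.of fun a b : Fin (2 * T) => ∑ l ∈ LUset T (2 * k + 1) (hatLen k a b) (a : ℕ) (b : ℕ),
      (npieces l : ℝ) * ((npieces l : ℝ) - 1) * wD T (stripYT T) l)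
    (fun k => by rw [hat_piecesSq_ren hyT.le k]; rfl) a a b
  -- the value: `(Σ_c L̂_{ac}L̂_{ca})/L̂_{aa} = 2⟨ℓ,u⟩/dl`
  have hval : (∑ c, 2 * (1 / dl * (u a * ℓ c)) * (2 * (1 / dl * (u c * ℓ a)))) / (2 * (1 / dl * (u a * ℓ a))) =
      2 * (ℓ ⬝ᵥ u) / dl := by
    have hne : 2 * (1 / dl * (u a * ℓ a)) ≠ 0 := by have := hu0 a; have := hℓ0 a; positivity
    rw [div_eq_iff hne, dotProduct]
    have hdl0 : dl ≠ 0 := hl.ne'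
    have hterm : ∀ c, 2 * (1 / dl * (u a * ℓ c)) * (2 * (1 / dl * (u c * ℓ a))) =
        (ℓ c * u c) * ((2 / dl) * (2 * (1 / dl * (u a * ℓ a)))) := fun c => by ring
    simp_rw [hterm]
    rw [← sum_mul]
    field_simp
  simp only [Matrix.of_apply] at hQ
  rw [hval] at hQ
  -- from `(k+1)²` to `n_k²`
  have h2 := (tendsto_succ_div_hatLen_half (T := T) a b).pow 2
  have h := hQ.mul h2
  have hlimval : (2 * (ℓ ⬝ᵥ u) / dl) ^ 2 * (1 / 2) ^ 2 = ((ℓ ⬝ᵥ u) / dl) ^ 2 := by ring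
  rw [hlimval] at h
  refine h.congr' ?_
  have hden : Tendsto (fun k : ℕ => (hatLen k a b : ℝ)) atTop atTop := by
    have hL : ∀ k : ℕ, (hatLen k a b : ℝ) = 2 * (k : ℝ) + ((lchi a - lchi b : ℤ) : ℝ) := fun k => by
      unfold hatLen; push_cast; ring
    simp_rw [hL]
    exact (tendsto_natCast_atTop_atTop.const_mul_atTop two_pos).atTop_add tendsto_const_nhds
  have hKD : ∀ k, K.D k a b = hatD T (stripYT T) k a b := fun k => rfl
  filter_upwards [hden.eventually_gt_atTop 0] with k hk
  have hk1 : (k : ℝ) + 1 ≠ 0 := by positivity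
  rw [hKD k]
  by_cases hD : hatD T (stripYT T) k a b = 0
  · simp [hD]
  · field_simp

/-- ★★★★ **THE VARIANCE OF THE PIECE DENSITY VANISHES** (`T ≥ 2`): for all levels `a, b`, along `n_k`, with `ν_T = ⟨ℓ,u⟩/⟨ℓ, M̄_len u⟩`,
`Σ_{bridges a→b, n_k steps} (npieces − ν_T·n_k)² · wD  /  (n_k² · D̂(k)_{ab}) ⟶ 0`
— i.e. under the critical weighting `x_c^{n} y_T^{#top}` normalised to a probability on the bridges `a → b` with `n` steps, `E[(N/n − ν_T)²] → 0`: the number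
of renewal vertices per step converges to `ν_T` in quadratic mean.  Assembled from the second factorial moment (`→ ν²`), the first moment (`→ ν`, the tree's
`tendsto_pieces_per_step`) and `(N − νn)² = N(N−1) + N − 2νnN + ν²n²`. [cite: Feller1968, XIII.3, XIII.6 (mean and variance of the number of renewals); DuminilCopinHammond2013, §2.2; lane «pcv-sawmu» a-p2 g24 — own result] -/
theorem tendsto_pieces_variance (hT : 2 ≤ T) (hu0 : ∀ a, 0 < u a) (hℓ0 : ∀ b, 0 < ℓ b)
    (hu : Iinf T (stripYT T) *ᵥ u = u) (hℓ : ℓ ᵥ* Iinf T (stripYT T) = ℓ) (a b : Fin (2 * T)) :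
    Tendsto (fun k : ℕ => (∑ l ∈ LUset T (2 * k + 1) (hatLen k a b) (a : ℕ) (b : ℕ),
          ((npieces l : ℝ) - (ℓ ⬝ᵥ u) / (ℓ ⬝ᵥ ((Matrix.of fun a b : Fin (2 * T) =>
            ∑' n : ℕ, (n : ℝ) * LMM T n (n : ℤ) (stripYT T) a b) *ᵥ u)) * (hatLen k a b : ℝ)) ^ 2 * wD T (stripYT T) l) /
        ((hatLen k a b : ℝ) ^ 2 * hatD T (stripYT T) k a b)) atTop (𝓝 0) := by
  set ν : ℝ := (ℓ ⬝ᵥ u) / (ℓ ⬝ᵥ ((Matrix.of fun a b : Fin (2 * T) =>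
    ∑' n : ℕ, (n : ℝ) * LMM T n (n : ℤ) (stripYT T) a b) *ᵥ u)) with hν
  set S := fun k : ℕ => LUset T (2 * k + 1) (hatLen k a b) (a : ℕ) (b : ℕ) with hS
  set w := fun l : List HV => wD T (stripYT T) l with hw
  have hQ := tendsto_piecesSq_per_step_sq hT hu0 hℓ0 hu hℓ a b
  have hP := tendsto_pieces_per_step hT hu0 hℓ0 hu hℓ a b
  rw [← hν] at hQ hP
  have hden : Tendsto (fun k : ℕ => (hatLen k a b : ℝ)) atTop atTop := by
    have hL : ∀ k : ℕ, (hatLen k a b : ℝ) = 2 * (k : ℝ) + ((lchi a - lchi b : ℤ) : ℝ) := fun k => by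
      unfold hatLen; push_cast; ring
    simp_rw [hL]
    exact (tendsto_natCast_atTop_atTop.const_mul_atTop two_pos).atTop_add tendsto_const_nhds
  have hinv : Tendsto (fun k : ℕ => 1 / (hatLen k a b : ℝ)) atTop (𝓝 0) := tendsto_const_nhds.div_atTop hden
  -- `Q/(n²D) + (1/n)(P/(nD)) − 2ν (P/(nD)) + ν²·[D ≠ 0] → ν² + 0 − 2ν² + ν² = 0`
  have hlim : Tendsto (fun k : ℕ =>
      (∑ l ∈ S k, (npieces l : ℝ) * ((npieces l : ℝ) - 1) * w l) / ((hatLen k a b : ℝ) ^ 2 * hatD T (stripYT T) k a b) +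
        (1 / (hatLen k a b : ℝ)) * ((∑ l ∈ S k, (npieces l : ℝ) * w l) / ((hatLen k a b : ℝ) * hatD T (stripYT T) k a b)) -
        2 * ν * ((∑ l ∈ S k, (npieces l : ℝ) * w l) / ((hatLen k a b : ℝ) * hatD T (stripYT T) k a b)) + ν ^ 2)
      atTop (𝓝 (ν ^ 2 + 0 * ν - 2 * ν * ν + ν ^ 2)) :=
    ((hQ.add (hinv.mul hP)).sub (hP.const_mul (2 * ν))).add tendsto_const_nhds
  have hzero : ν ^ 2 + 0 * ν - 2 * ν * ν + ν ^ 2 = 0 := by ring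
  rw [hzero] at hlim
  -- eventually `D̂(k)_{ab} > 0`, and then the two sides agree
  have hT1 : 1 ≤ T := by omega
  have hyT : 0 < stripYT T := stripYT_pos hT1
  obtain ⟨hl, hL⟩ := tendsto_stripLenD_residue_explicit hT hu0 hℓ0 hu hℓ
  have hres : ∀ a b, Tendsto (fun s : ℝ => (1 - s) * stripLenD T s a b) (𝓝[<] 1)
      (𝓝 (1 / (ℓ ⬝ᵥ ((Matrix.of fun a b : Fin (2 * T) => ∑' n : ℕ, (n : ℝ) * LMM T n (n : ℤ) (stripYT T) a b) *ᵥ u)) *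
        (u a * ℓ b))) := fun a b => by
    have := hL a b
    rwa [show u a * ℓ b / _ = 1 / (ℓ ⬝ᵥ ((Matrix.of fun a b : Fin (2 * T) => ∑' n : ℕ, (n : ℝ) * LMM T n (n : ℤ) (stripYT T) a b) *ᵥ u)) *
      (u a * ℓ b) by ring] at this
  have hcrit := hatPair_critical hT hu0 hℓ0 (one_div_pos.2 hl) hres
  have hDlim := (hatPair T hyT.le).tendsto_coeff hcrit a b
  have hDpos : ∀ᶠ k : ℕ in atTop, 0 < hatD T (stripYT T) k a b := by
    have hpos : 0 < 2 * (1 / (ℓ ⬝ᵥ ((Matrix.of fun a b : Fin (2 * T) => ∑' n : ℕ, (n : ℝ) * LMM T n (n : ℤ) (stripYT T) a b) *ᵥ u)) *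
        (u a * ℓ b)) := by have := hu0 a; have := hℓ0 b; positivity
    exact hDlim.eventually (eventually_gt_nhds hpos)
  refine hlim.congr' ?_
  filter_upwards [hden.eventually_gt_atTop 0, hDpos] with k hk hDk
  have hn0 : (hatLen k a b : ℝ) ≠ 0 := hk.ne'
  have hD0 : hatD T (stripYT T) k a b ≠ 0 := hDk.ne'
  -- expand the square inside the sum
  have hsum : ∑ l ∈ S k, ((npieces l : ℝ) - ν * (hatLen k a b : ℝ)) ^ 2 * w l =
      ∑ l ∈ S k, (npieces l : ℝ) * ((npieces l : ℝ) - 1) * w l + ∑ l ∈ S k, (npieces l : ℝ) * w l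
        - 2 * ν * (hatLen k a b : ℝ) * ∑ l ∈ S k, (npieces l : ℝ) * w l + ν ^ 2 * (hatLen k a b : ℝ) ^ 2 * ∑ l ∈ S k, w l := by
    rw [mul_sum, mul_sum, ← sum_add_distrib, ← sum_sub_distrib, ← sum_add_distrib]
    exact sum_congr rfl fun l _ => by ring
  have hDsum : hatD T (stripYT T) k a b = ∑ l ∈ S k, w l := by rw [hatD, LUM, LUs]
  rw [hsum, hDsum]
  rw [hDsum] at hD0
  field_simp

/-- ★★★★ **WEAK LAW OF LARGE NUMBERS FOR THE RENEWAL VERTICES OF A LONG CRITICAL BRIDGE** (`T ≥ 2`; Chebyshev).  For all levels `a, b`, every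
`ε > 0`, along `n_k = 2k + χ_a − χ_b`:
`(Σ_{bridges a→b with n_k steps and |npieces/n_k − ν_T| ≥ ε} wD) / D̂(k)_{ab} ⟶ 0`
— the critical weight of the bridges whose number of irreducible pieces (= renewal vertices + 1) per step deviates from `ν_T = ⟨ℓ,u⟩/⟨ℓ, M̄_len u⟩` by `ε`
is negligible: `npieces/n → ν_T` in probability under the critical bridge weighting. [cite: Feller1968, XIII.6 (variance of the number of renewals; Chebyshev); DuminilCopinHammond2013, §2.2 (renewal points); lane «pcv-sawmu» a-p2 g24 — own result, not in print] -/
theorem tendsto_pieces_deviation (hT : 2 ≤ T) (hu0 : ∀ a, 0 < u a) (hℓ0 : ∀ b, 0 < ℓ b)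
    (hu : Iinf T (stripYT T) *ᵥ u = u) (hℓ : ℓ ᵥ* Iinf T (stripYT T) = ℓ) (a b : Fin (2 * T)) {ε : ℝ} (hε : 0 < ε) :
    Tendsto (fun k : ℕ => (∑ l ∈ (LUset T (2 * k + 1) (hatLen k a b) (a : ℕ) (b : ℕ)).filter (fun l =>
          ε ≤ |(npieces l : ℝ) / (hatLen k a b : ℝ) - (ℓ ⬝ᵥ u) / (ℓ ⬝ᵥ ((Matrix.of fun a b : Fin (2 * T) =>
            ∑' n : ℕ, (n : ℝ) * LMM T n (n : ℤ) (stripYT T) a b) *ᵥ u))|), wD T (stripYT T) l) /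
        hatD T (stripYT T) k a b) atTop (𝓝 0) := by
  set ν : ℝ := (ℓ ⬝ᵥ u) / (ℓ ⬝ᵥ ((Matrix.of fun a b : Fin (2 * T) =>
    ∑' n : ℕ, (n : ℝ) * LMM T n (n : ℤ) (stripYT T) a b) *ᵥ u)) with hν
  have hV := tendsto_pieces_variance hT hu0 hℓ0 hu hℓ a b
  rw [← hν] at hV
  have hyT : 0 < stripYT T := stripYT_pos (by omega)
  have hden : Tendsto (fun k : ℕ => (hatLen k a b : ℝ)) atTop atTop := by
    have hL : ∀ k : ℕ, (hatLen k a b : ℝ) = 2 * (k : ℝ) + ((lchi a - lchi b : ℤ) : ℝ) := fun k => by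
      unfold hatLen; push_cast; ring
    simp_rw [hL]
    exact (tendsto_natCast_atTop_atTop.const_mul_atTop two_pos).atTop_add tendsto_const_nhds
  -- squeeze: `0 ≤ bad/D ≤ ε⁻² · variance`
  have hup := hV.const_mul (1 / ε ^ 2)
  rw [mul_zero] at hup
  refine tendsto_of_tendsto_of_tendsto_of_le_of_le' tendsto_const_nhds hup ?_ ?_
  · filter_upwards with k
    exact div_nonneg (sum_nonneg fun l _ => wD_nonneg T hyT.le _) (LMM_LUM_nonneg hyT.le _ a b).2
  · filter_upwards [hden.eventually_gt_atTop 0] with k hk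
    set n : ℝ := (hatLen k a b : ℝ) with hn
    set S := LUset T (2 * k + 1) (hatLen k a b) (a : ℕ) (b : ℕ) with hS
    have hD0 : 0 ≤ hatD T (stripYT T) k a b := (LMM_LUM_nonneg hyT.le _ a b).2
    -- pointwise Chebyshev: on a deviating bridge `w ≤ ε⁻² (N/n − ν)² w`
    have hpt : ∀ l ∈ S, ε ≤ |(npieces l : ℝ) / n - ν| →
        wD T (stripYT T) l ≤ (1 / ε ^ 2) * (((npieces l : ℝ) - ν * n) ^ 2 * wD T (stripYT T) l / n ^ 2) := by
      intro l _ hbad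
      have hw0 := wD_nonneg T hyT.le l
      have hdev : ε ^ 2 ≤ ((npieces l : ℝ) / n - ν) ^ 2 := by
        calc ε ^ 2 = |ε| ^ 2 := by rw [abs_of_pos hε]
          _ ≤ |(npieces l : ℝ) / n - ν| ^ 2 := pow_le_pow_left₀ (abs_nonneg ε) (by rwa [abs_of_pos hε]) 2
          _ = ((npieces l : ℝ) / n - ν) ^ 2 := sq_abs _
      have hid : ((npieces l : ℝ) - ν * n) ^ 2 * wD T (stripYT T) l / n ^ 2 = ((npieces l : ℝ) / n - ν) ^ 2 * wD T (stripYT T) l := by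
        field_simp
      have h1 : ε ^ 2 * wD T (stripYT T) l ≤ ((npieces l : ℝ) / n - ν) ^ 2 * wD T (stripYT T) l :=
        mul_le_mul_of_nonneg_right hdev hw0
      calc wD T (stripYT T) l = (1 / ε ^ 2) * (ε ^ 2 * wD T (stripYT T) l) := by field_simp
        _ ≤ (1 / ε ^ 2) * (((npieces l : ℝ) / n - ν) ^ 2 * wD T (stripYT T) l) := mul_le_mul_of_nonneg_left h1 (by positivity)
        _ = (1 / ε ^ 2) * (((npieces l : ℝ) - ν * n) ^ 2 * wD T (stripYT T) l / n ^ 2) := by rw [hid]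
    calc (∑ l ∈ S.filter (fun l => ε ≤ |(npieces l : ℝ) / n - ν|), wD T (stripYT T) l) / hatD T (stripYT T) k a b
        ≤ (∑ l ∈ S.filter (fun l => ε ≤ |(npieces l : ℝ) / n - ν|),
            (1 / ε ^ 2) * (((npieces l : ℝ) - ν * n) ^ 2 * wD T (stripYT T) l / n ^ 2)) / hatD T (stripYT T) k a b := by
          refine div_le_div_of_nonneg_right (sum_le_sum fun l hl => ?_) hD0
          rw [mem_filter] at hl
          exact hpt l hl.1 hl.2
      _ ≤ (∑ l ∈ S, (1 / ε ^ 2) * (((npieces l : ℝ) - ν * n) ^ 2 * wD T (stripYT T) l / n ^ 2)) / hatD T (stripYT T) k a b := by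
          refine div_le_div_of_nonneg_right (sum_le_sum_of_subset_of_nonneg (filter_subset _ _) fun l _ _ => ?_) hD0
          have := wD_nonneg T hyT.le l
          positivity
      _ = (1 / ε ^ 2) * ((∑ l ∈ S, ((npieces l : ℝ) - ν * n) ^ 2 * wD T (stripYT T) l) / (n ^ 2 * hatD T (stripYT T) k a b)) := by
          rw [← mul_sum, ← Finset.sum_div, mul_div_assoc, div_div]

end LLN


/-! ### §5 Width two: the renewal vertices of a long critical bridge of `S₂` concentrate at `(√2 − ½)·n` -/

section WidthTwo

open W2 in
/-- ★★★ **WIDTH TWO: `#pieces/n → √2 − ½` in probability.**  For every pair of levels `a, b` of `S₂` and every `ε > 0`, along `n_k = 2k + χ_a − χ_b`: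
`(Σ_{bridges a→b with n_k steps and |npieces/n_k − (√2 − ½)| ≥ ε} x_c^{n_k} y₂^{#top}) / D̂(k)_{ab} ⟶ 0`
— the weak law of §4 with the closed-form Perron data of «WIDTH-TWO-KERNEL» (#715: `W2.uTwo`, `W2.ellTwo`, `ν₂ = √2 − ½`).
[cite: Feller1968, XIII.6; DuminilCopinHammond2013, §2.2; BeatonBousquetMelouDeGierDuminilCopinGuttmann2014, Corollary 8 (the strip at (x_c, y_T)); lane «pcv-sawmu» a-p2 g24 — own result] -/
theorem widthTwo_pieces_deviation (a b : Fin (2 * 2)) {ε : ℝ} (hε : 0 < ε) :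
    Tendsto (fun k : ℕ => (∑ l ∈ (LUset 2 (2 * k + 1) (hatLen k a b) (a : ℕ) (b : ℕ)).filter (fun l =>
          ε ≤ |(npieces l : ℝ) / (hatLen k a b : ℝ) - (Real.sqrt 2 - 1 / 2)|), wD 2 (stripYT 2) l) /
        hatD 2 (stripYT 2) k a b) atTop (𝓝 0) := by
  have h := tendsto_pieces_deviation (T := 2) le_rfl uTwo_pos ellTwo_pos Iinf_two_fixed.1 Iinf_two_fixed.2 a b hε
  have hval : (ellTwo ⬝ᵥ uTwo) / (ellTwo ⬝ᵥ ((Matrix.of fun a b : Fin (2 * 2) =>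
      ∑' n : ℕ, (n : ℝ) * LMM 2 n (n : ℤ) (stripYT 2) a b) *ᵥ uTwo)) = Real.sqrt 2 - 1 / 2 := by
    rw [lengthMomentMatrix_two_eq, perron_scalars_two.1, perron_scalars_two.2]
    have hP := xc_minpoly
    have hpos : 0 < 20 - 8 * hexCriticalFugacity ^ 2 := by nlinarith [xc_sq_bounds.2]
    rw [div_eq_iff hpos.ne', sqrt_two_eq]
    linear_combination (-8 : ℝ) * hP
  rw [hval] at h
  exact h

end WidthTwo

end HV

end Literature.Probability.RandomPlanarGeometry.SAW
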